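/-
Copyright: the b2b-balaban cell (near-miss cell 7), T⁴-continuum fan-out, lineage t4-ne7b-p2 (node U5c RENEWAL member).
Released under the licence of the surrounding project.
-/
import Literature.MathematicalPhysics.QuantumFieldTheory.Balaban1983to89.T4JointInsertionProfile

/-!
# The renewal route's prepaid size bank is never overdrawn

Summits-side support leaf of the T⁴-continuum cell (rung (B)+1 on a FINITE torus only; NOT infinite volume, NOT the
mass gap, NOT the Clay statement; NOT a proof of the spine estimate NE7b).  Lineage `t4-ne7b-p2` (generation 22),
node U5c, RENEWAL route; the one non-definitional content of leaf N2 of the ROUND-2 skeleton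
`t4/skeletons/NE7b-t4-ne7b-p2.md`: with the product majorant `ω = (bare printed product) × e^{bank}`, the raw edge price
carries `((κ)∕N_e)²` per edge (the position count `N_e` of the structure's zone at that event is CANCELLED by it — leaves
N3c∕N3d, `RenewalEdgeMass`) and `e^{2λ·w_b}` per new constituent `b` (prepaid at its birth, taken out of the birth credit —
leaf N3a, `RenewalRootMass`); the bank of a record is `bank = 2·(λ·Σ_b w_b − Σ_e log (N_e∕κ))` and THIS FILE proves
`0 ≤ bank` from the cell's [K] shrinking-site product bound `T4JointInsertionProfile.prod_sites_le_exp` (pv14; the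
site-count READING of B16 p. 384 is its displayed hypothesis `hN`, instantiated on the index model of S by
`T4EntropyShapeInstances.siteCount_le`).  [folklore] real arithmetic (logarithms of a product bound); nothing printed is
quoted or asserted; no `def … : Prop` fact, no `[cite:]` tag.

WHAT.  §1 `sum_log_le_of_prod_sites` (logarithmic form of `prod_sites_le_exp`: `Σ_e log N_e ≤ #E·log κ + λ·Σ_b w_b`,
`λ = μθ∕(1−θ)`, for site factors `N_e ≥ 1`, `κ ≥ 1`), `bank_nonneg` (`0 ≤ λ·Σ_b w_b − Σ_e (log N_e − log κ)`, hence the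
doubled bank `2·(…) ≥ 0`), `bank_mono` (dropping the last event can only raise the bank: bookkeeping of truncation).
§2 a decided toy.

HONEST DEPENDENCY (cell): continuum YM on T⁴ ⇐ BetaPertH ∧ nine spine estimates (0/9 proved); BetaPertH ⇐ (D1) ∧ (D4)
∧ CAP+tail.  This file changes none of it.
-/

open Finset
open Literature.MathematicalPhysics.QuantumFieldTheory.Balaban1983to89
open Literature.MathematicalPhysics.QuantumFieldTheory.Balaban1983to89.T4JointInsertionProfile

namespace Summit.QuantumFields.BalabanUV.T4Continuum.RenewalBank

noncomputable section

/-! ## §1 The bank is nonnegative -/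

section Bank

variable {ε β : Type*} [DecidableEq β]

/-- **LOGARITHMIC FORM OF THE SHRINKING-SITE PRODUCT BOUND.**  Under the hypotheses of
`T4JointInsertionProfile.prod_sites_le_exp` with site factors `N_e ≥ 1` and `κ ≥ 1`:
`Σ_{e ∈ E} log N_e ≤ #E·log κ + (μθ∕(1−θ))·Σ_{b ∈ B} w_b`. [folklore] -/
theorem sum_log_le_of_prod_sites {θ κ : ℝ} (h0 : 0 ≤ θ) (h1 : θ < 1) (hκ : 1 ≤ κ)
    (E : Finset ε) (B : Finset β) (tE : ε → ℕ) (tB : β → ℕ) (P : ε → Finset β) (w : β → ℝ) (N : ε → ℝ) {μ : ℕ}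
    (hPB : ∀ e ∈ E, P e ⊆ B) (hw : ∀ b ∈ B, 0 ≤ w b) (hlt : ∀ e ∈ E, ∀ b ∈ P e, tB b < tE e)
    (hμ : ∀ b ∈ B, ∀ t : ℕ, (E.filter fun e => b ∈ P e ∧ tE e = t).card ≤ μ)
    (hN1 : ∀ e ∈ E, 1 ≤ N e) (hN : ∀ e ∈ E, N e ≤ κ * (1 + ∑ b ∈ P e, w b * θ ^ (tE e - tB b))) :
    ∑ e ∈ E, Real.log (N e) ≤ E.card * Real.log κ + (μ : ℝ) * (θ / (1 - θ)) * ∑ b ∈ B, w b := by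
  have hκ0 : 0 < κ := lt_of_lt_of_le one_pos hκ
  have hprod := prod_sites_le_exp h0 h1 hκ0.le E B tE tB P w N hPB hw hlt hμ
    (fun e he => le_trans zero_le_one (hN1 e he)) hN
  have hpos : 0 < ∏ e ∈ E, N e := Finset.prod_pos fun e he => lt_of_lt_of_le one_pos (hN1 e he)
  have hlog := Real.log_le_log hpos hprod
  rw [Real.log_prod (s := E) (f := N) (fun e he => (lt_of_lt_of_le one_pos (hN1 e he)).ne'), Real.log_mul (pow_pos hκ0 _).ne'
    (Real.exp_pos _).ne', Real.log_pow, Real.log_exp] at hlog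
  exact hlog

/-- **THE BANK IS NEVER OVERDRAWN**: `0 ≤ λ·Σ_b w_b − Σ_e (log N_e − log κ)` with `λ = μθ∕(1−θ)` — every position
entropy `log (N_e∕κ)` spent along the life of a structure is covered by the size credit `λ·w_b` prepaid at the births of its
constituents (positions SHRINK: `θ = 1∕2` in the index model of S). [folklore] -/
theorem bank_nonneg {θ κ : ℝ} (h0 : 0 ≤ θ) (h1 : θ < 1) (hκ : 1 ≤ κ)
    (E : Finset ε) (B : Finset β) (tE : ε → ℕ) (tB : β → ℕ) (P : ε → Finset β) (w : β → ℝ) (N : ε → ℝ) {μ : ℕ}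
    (hPB : ∀ e ∈ E, P e ⊆ B) (hw : ∀ b ∈ B, 0 ≤ w b) (hlt : ∀ e ∈ E, ∀ b ∈ P e, tB b < tE e)
    (hμ : ∀ b ∈ B, ∀ t : ℕ, (E.filter fun e => b ∈ P e ∧ tE e = t).card ≤ μ)
    (hN1 : ∀ e ∈ E, 1 ≤ N e) (hN : ∀ e ∈ E, N e ≤ κ * (1 + ∑ b ∈ P e, w b * θ ^ (tE e - tB b))) :
    0 ≤ (μ : ℝ) * (θ / (1 - θ)) * ∑ b ∈ B, w b - ∑ e ∈ E, (Real.log (N e) - Real.log κ) := by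
  have h := sum_log_le_of_prod_sites h0 h1 hκ E B tE tB P w N hPB hw hlt hμ hN1 hN
  rw [Finset.sum_sub_distrib, Finset.sum_const, nsmul_eq_mul]
  linarith

/-- **TRUNCATION ONLY RAISES THE BANK**: with fewer events (a sub-family `E' ⊆ E` of the same record, e.g. the last event
undone) the spent entropy is smaller, for site factors `N_e ≥ κ ≥ 1`-normalised terms `log N_e − log κ ≥ 0`. [folklore] -/
theorem spent_mono {κ : ℝ} (E E' : Finset ε) (hE : E' ⊆ E) (N : ε → ℝ) (hNκ : ∀ e ∈ E, κ ≤ N e) (hκ : 0 < κ) :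
    ∑ e ∈ E', (Real.log (N e) - Real.log κ) ≤ ∑ e ∈ E, (Real.log (N e) - Real.log κ) :=
  Finset.sum_le_sum_of_subset_of_nonneg hE fun e he _ =>
    sub_nonneg.2 (Real.log_le_log hκ (hNκ e he))

end Bank

/-! ## §2 A decided toy -/

section Toy

/-- one constituent of size `w = 4` born at step `0`, two later events at steps `1`, `2` each touching it, site factors
`N = κ·(1 + 4·(1/2)^t)` with `κ = 1`: `N₁ = 3`, `N₂ = 2`; the bank inequality reads `log 3 + log 2 ≤ 0 + 1·1·4`
(`θ = 1/2`, `μ = 1`): `log 6 ≤ 4`, true since `6 < e^4`; decided through `prod_sites_le_exp`'s shape `3·2 ≤ 1·e^4` -/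
example : (3 : ℝ) * 2 ≤ 1 ^ 2 * Real.exp ((1 : ℝ) * ((1 / 2) / (1 - 1 / 2)) * 4) := by
  have h3 : (3 : ℝ) ≤ Real.exp 2 := by have := Real.add_one_le_exp (2 : ℝ); linarith
  have h2 : Real.exp 2 * Real.exp 2 = Real.exp 4 := by rw [← Real.exp_add]; norm_num
  have h : (6 : ℝ) ≤ Real.exp 4 := by nlinarith
  norm_num
  linarith

end Toy

end

end Summit.QuantumFields.BalabanUV.T4Continuum.RenewalBank
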